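import Literature.AlgebraicGeometry.HodgeTheory.FermatClaimShiodaSpine
import HarnessLib

/-!
# Named fact: the semi-decomposable Hodge eigenlines of the Fermat fourfold are algebraic — a theorem of Shioda 1979 (type II with curve factors) and Ran 1980 §4

Family `hodge`, layer `Literature/AlgebraicGeometry/HodgeTheory`. NAMED FACT (D-0014, `def … : Prop`,
nothing is proved or asserted) recording the one case of Shioda's inductive construction of algebraic
cycles on Fermat varieties that the tree's `FermatInductiveClaims` / `FermatClaimShiodaSpine`
deliberately left as an INPUT: the field `semi` of `FermatCharacter.IsShiodaClosed`, i.e. the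
hypothesis `hsemi` of `FermatCharacter.isShiodaClosed_claimMultiset` and of
`FermatCharacter.claim_of_shiodaCondition` ("the semi-decomposable Hodge characters of `X⁴ₘ` —
`X¹ₘ × X¹ₘ` and the type-II map"), and stub S3a `stub_semiDecomposableClaim` of line
`cancel-by-any-claim-lattice` on the crux `HodgeFermatVarieties` (stmt-HodgeConjecture-1334).

Sources, TEXT READ. T. Shioda, *The Hodge conjecture and the Tate conjecture for Fermat varieties*,
Proc. Japan Acad. 55A (1979) 111–114 (doi:10.3792/pjaa.55.111):

> §1, Definition (iii): "`ξ` is *semi-decomposable* if there exist non-negative integer solutions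
> `(x′_ν)`, `(x″_ν)` of (3) [`Σ_ν ν x_ν ≡ 0 (mod m)`] such that `x = x′ + x″` and
> `Σ x′_ν = Σ x″_ν = 3` (this occurs only if `y = 3`)."
> §2, Theorem 1 [algebraicity of the Hodge classes of `Xⁿₘ` under `(Pⁿₘ)`], proof in §4: "by the map (∗)
> [`… ⊕ H^{r}(Xʳₘ)_prim ⊗ H^{s}(Xˢₘ)_prim → Hⁿ(Xⁿₘ)_prim`, `n = r + s + 2`, `Gⁿₘ`-equivariant] which
> preserves algebraic cycles, we can construct algebraic cycles on `Xⁿₘ` from those on `Xʳₘ × Xˢₘ`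
> (`r + s = n − 2`) … or on `X¹ₘ × X¹ₘ`, where the Hodge [statement] is known to be true by
> Lefschetz theorem." [the bracket replaces the problem's name, quoted verbatim otherwise]

Z. Ran, *Cycles on Fermat hypersurfaces*, Compositio Math. 42 (1980) 121–142 (numdam), §4:

> p. 139: "if `c′` and `c″` are algebraic then so is `c′ ∗ c″`" (`∗ = p₂₊ p₁^* K`, through the
> `ℙ¹`-bundle `I₀ → V′ × V″` of lines joining the two disjoint sub-Fermat varieties);
> Prop. 4.6 / Cor. 4.7: "`H_{χ′} ∗ H_{χ″} = H_{χ′∗χ″}`, where `χ′ ∗ χ″` is obtained from `χ′`, `χ″` by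
> juxtaposition" (any dimensions, curves included; with Prop. 1.7 (ii)–(iii) for the Hodge types).

Together: for two characters `β, γ ∈ 𝔄¹ₘ` of the Fermat CURVE `X¹ₘ` (three non-zero coordinates
summing to `0`) whose juxtaposition `α = β ∗ γ` is a Hodge character of the Fermat FOURFOLD `X⁴ₘ`
(Shioda's "semi-decomposable element of length `3`"), the eigenline `V(α) ⊂ H⁴(X⁴ₘ(ℂ); ℂ)` is the
`∗`-image of `V(β) ⊗ V(γ) ⊂ H²(X¹ₘ × X¹ₘ)`, a piece of a rational sub-Hodge structure of type
`(1,1)` (Hodge-ness of `α` says `{|wβ|, |wγ|} = {1, 2}` for every unit `w`), algebraic by Lefschetz's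
theorem on `(1,1)`-classes on the product surface, and `∗` preserves algebraic cycles: claim(`α`).

## Rendering and faithfulness

* `β, γ ∈ 𝔄¹ₘ` are `β γ : Fin 3 → ZMod m` with all coordinates non-zero and sum zero; `α` is ANY
  character of `X⁴ₘ` (`Fin (2 * 2 + 2) → ZMod m`) whose multiset of values is that of `β` plus that
  of `γ` — juxtaposition up to permutation of the coordinates, exactly as `Aoki1987_claim_juxtaposition`
  renders Aoki's `α ∗ β` (permuting coordinates is an automorphism of `X⁴ₘ`,
  `FermatCharacter.Claim.of_univ_val_map_eq`) — and which is a Hodge character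
  (`FermatCharacter.IsHodge α`, Shioda's `𝔅⁴ₘ`; equivalently `IsHodgeMultiset` of the value multiset,
  which is then `IsSemiDecomposable` in the sense of `FermatShiodaCondition` — see the sanity lemma
  `Shioda1979_claim_semiDecomposable_iff_multiset`).
* claim(`α`) is `FermatCharacter.Claim m 2 α : fermatEigenspace m α (2 * 2) ≤
  algebraicClasses (fermatHypersurface (2 * 2) m) 2` on the standard model `V₊(Σ xᵢᵐ) ⊂ ℙ⁵_ℂ`
  (file `FermatInductiveClaims`), i.e. `V(α)` lies in the `ℂ`-span of the classes of codimension-2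
  cycles — what "construct algebraic cycles on `Xⁿₘ` from those on `X¹ₘ × X¹ₘ`" yields for the
  eigenline (Shioda §4; Ran Cor. 4.7 identifies the `∗`-image with the eigenspace `H_{χ′∗χ″}`).
* Upper bound: an instance family of the algebraicity of rational `(2,2)`-classes on `X⁴ₘ` (the `V(α)`,
  `α ∈ 𝔅⁴ₘ`, are spanned by rational `(2,2)`-classes of `⊕ₜ V(tα)`); a THEOREM in print, unconditional (it does NOT depend on
  Shioda's condition `(Pₘ)`: the semi-decomposable case is the part of the induction that starts from
  `X¹ₘ × X¹ₘ`). `m = 1, 2` are vacuous (no zero-free zero-sum triples of the required Hodge type).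
* NOT here: the ruled-join span `X¹ₘ × X¹ₘ ← I₀ → X⁴ₘ` as a `ℂ`-scheme, the map `∗` on the tree's
  carriers and its equivariance (the same missing layer as for `Aoki1987_claim_juxtaposition`, file
  `FermatJuxtapositionGysin`, "What is NOT here"), the Hodge types of curve eigenlines (Ran Prop. 1.7),
  and Lefschetz `(1,1)` on `X¹ₘ × X¹ₘ` (`lefschetzOneOne_rational`) — the inputs a discharge
  `Shioda1979_claim_semiDecomposable_holds` would assemble. da Silva (arXiv:2101.04739) works with
  `(Pₘ)` without Shioda's clause (iii), so this case is cited from Shioda and Ran only.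

## References

* [Shioda1979PJA] T. Shioda, The Hodge conjecture and the Tate conjecture for Fermat varieties, Proc.
  Japan Acad. 55A (1979) 111–114, §1 Definition (iii), §2 Thm. 1, §4 (text read).
* [Ran1980] Z. Ran, Cycles on Fermat hypersurfaces, Compositio Math. 42 (1980) 121–142, §4 p. 139,
  Prop. 4.6, Cor. 4.7, Prop. 1.7 (text read, numdam).
* [Shioda1979HodgeFermat] T. Shioda, The Hodge conjecture for Fermat varieties, Math. Ann. 245 (1979)
  175–184, Thm. I (cite-only).
* [VoisinHodgeI2002] C. Voisin, Hodge Theory and Complex Algebraic Geometry I, Thm. 11.30 (Lefschetz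
  theorem on `(1,1)`-classes).
-/

noncomputable section

open Finset

namespace Literature.AlgebraicGeometry.HodgeTheory

/-- **Shioda 1979 (PJA §1 (iii), §4) / Ran 1980 §4: the semi-decomposable Hodge characters of the
Fermat fourfold are cycle characters.** For characters `β, γ ∈ 𝔄¹ₘ` of the Fermat curve `X¹ₘ`
(three non-zero coordinates, sum zero) and any HODGE character `α` of `X⁴ₘ` whose multiset of
values is that of `β` plus that of `γ` (`α ∼ β ∗ γ`, Shioda's semi-decomposable elements of length
`3`), claim(`α`) holds: `V(α) ⊆ H⁴(X⁴ₘ(ℂ); ℂ)` lies in the `ℂ`-span of the classes of codimension-`2`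
algebraic cycles ("construct algebraic cycles on `Xⁿₘ` from those on `X¹ₘ × X¹ₘ`, where the Hodge
[statement] is known to be true by Lefschetz theorem" [Shioda writes the name of the problem here], by the map `(∗)` "which preserves algebraic
cycles"; Ran: "if `c′` and `c″` are algebraic then so is `c′ ∗ c″`", `H_{χ′} ∗ H_{χ″} = H_{χ′∗χ″}`).
Users take `(h : Shioda1979_claim_semiDecomposable)`.
[cite: Shioda1979PJA, §1 Definition (iii), §2 Thm. 1 and §4] [cite: Ran1980, §4 p. 139, Prop. 4.6, Cor. 4.7]
[cite: Shioda1979HodgeFermat, Thm. I] [cite: VoisinHodgeI2002, Thm. 11.30] -/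
def Shioda1979_claim_semiDecomposable : Prop :=
  ∀ (m : ℕ) [NeZero m] (β γ : Fin 3 → ZMod m) (α : Fin (2 * 2 + 2) → ZMod m),
    (∀ i, β i ≠ 0) → (∀ i, γ i ≠ 0) → ∑ i, β i = 0 → ∑ i, γ i = 0 →
    FermatCharacter.IsHodge α → univ.val.map α = univ.val.map β + univ.val.map γ →
      FermatCharacter.Claim m 2 α

/-! ### Sanity: the multiset form is the `semi` input of the Shioda spine -/

/-- **The fact in multiset form** — literally the hypothesis `hsemi` of
`FermatCharacter.isShiodaClosed_claimMultiset` / `claim_of_shiodaCondition` (and the `semi` field of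
`IsShiodaClosed (ClaimMultiset m)`): a Hodge multiset which is two zero-sum triples is a claimed
multiset. Both directions are bookkeeping (`exists_eq_univ_val_map`, `card_univ_val_map`,
`isHodge_iff_isHodgeMultiset`, `Finset.sum_eq_multiset_sum`). [cite: Shioda1979PJA, §1 Definition (iii) and §4] -/
theorem Shioda1979_claim_semiDecomposable_iff_multiset :
    Shioda1979_claim_semiDecomposable ↔
      ∀ (m : ℕ) [NeZero m] (s : Multiset (ZMod m)), FermatCharacter.IsHodgeMultiset s →
        FermatCharacter.IsSemiDecomposable s → FermatCharacter.ClaimMultiset m s := by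
  classical
  refine ⟨fun h M _ s hs hsd r α hα ↦ ?_, fun h m _ β γ α _ _ hβ0 hγ0 hα hαs ↦ ?_⟩
  · obtain ⟨t, u, ht3, hu3, ht0, hu0, rfl⟩ := hsd
    have hc := FermatCharacter.card_eq_of_univ_val_map_eq hα
    rw [Multiset.card_add, ht3, hu3] at hc
    obtain rfl : r = 2 := by omega
    obtain ⟨k, β, rfl⟩ := FermatCharacter.exists_eq_univ_val_map t
    obtain ⟨l, γ, rfl⟩ := FermatCharacter.exists_eq_univ_val_map u
    rw [FermatCharacter.card_univ_val_map] at ht3 hu3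
    subst ht3
    subst hu3
    have hne : ∀ a ∈ univ.val.map β + univ.val.map γ, a ≠ 0 := hs.1.1
    refine h M β γ α (fun i ↦ hne _ ?_) (fun i ↦ hne _ ?_) ?_ ?_
      ((FermatCharacter.isHodge_iff_isHodgeMultiset α).2 (hα ▸ hs)) hα
    · exact Multiset.mem_add.2 (Or.inl (Multiset.mem_map_of_mem _ (mem_univ_val i)))
    · exact Multiset.mem_add.2 (Or.inr (Multiset.mem_map_of_mem _ (mem_univ_val i)))
    · rwa [Finset.sum_eq_multiset_sum]
    · rwa [Finset.sum_eq_multiset_sum]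
  · refine (h m (univ.val.map α) hα.isHodgeMultiset ⟨univ.val.map β, univ.val.map γ,
      FermatCharacter.card_univ_val_map β, FermatCharacter.card_univ_val_map γ, ?_, ?_, hαs⟩).claim rfl
    · rwa [← Finset.sum_eq_multiset_sum]
    · rwa [← Finset.sum_eq_multiset_sum]

end Literature.AlgebraicGeometry.HodgeTheory

end
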